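import Summits.ValiantsHypothesis.ValiantsHypothesis.Theorems.LacunarySymmetroidMatrixDescartesCensusDefiniteMiddleFutureTypeK3

/-!
# `MatrixDescartes` census — DOOR A, interior-definite-letter programme at `(2,3)`: the PAST-TYPE LAW for a positive
# definite middle letter (at most FOUR positive det-roots of negative type), the analytic half of IDL(3)

HONEST FRAMING.  Object-search cell `pub-symmetroid`, door-A seat `val-sym-door-p4` (gen 15); items stmt-ValiantsHypothesis-19979
`DoorA26` / 19980 `DoorA34` (OPEN, typed, never asserted); helper `--supports 19979`, NO closure claim.  Companion of
`…CensusDefiniteMiddleFutureTypeK3` (future type: at most two).  Nothing here bounds `ζ_sym(2,6)`, decides `DoorA26`/`DoorA34`,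
or bears on `MatrixDescartes` (stmt-ValiantsHypothesis-18050) / `VP ≠ VNP`.

CONTENT (memo `IDL-doorp4g15.md` §3 (H)).  For `F(x) = S₀ + x^d·1 + x^e·S₂` (`S₀, S₂` real symmetric, `0 < d < e`) a positive
det-root `r` of NEGATIVE type (`tr F(r) ≤ 0`, i.e. `F(r) ⪯ 0`) is a zero at `y = r^e` of
`H(y) = y^a + t₀ + t₂·y + N(y)`, `a = d/e ∈ (0,1)`, `N(y) = √((p₁ + y q₁)² + (p₂ + y q₂)²) = ‖p + y q‖` (trace-free parts).
**`pastModel_five_zeros`: `H` has at most four zeros on `(0,∞)`.**  Proof: with `Δ = p₁q₂ − p₂q₁`, `L = (p₁+yq₁)q₁ + (p₂+yq₂)q₂`,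
`σ = q₁² + q₂²` one has the Lagrange identity `σ·N² − L² = Δ²`; if `Δ ≠ 0` then `N > 0`, `N' = L/N`, `N'' = Δ²/N³`, so
`H'' = Δ²/N³ − a(1−a)y^{a−2}` vanishes exactly where `N(y) = c·y^{(2−a)/3}` (`c³ = Δ²/(a(1−a))`), which happens at most twice
because `N` is convex and `y^{(2−a)/3}` strictly concave; Rolle twice turns five zeros of `H` into three zeros of `H''`.  If
`Δ = 0` then `N = |L|/√σ` is affine on each side of its kink (or constant when `σ = 0`) and `H` is strictly concave there: at most
two zeros per side.

* `three_zeros_of_strictConvexOn`, `strictConcaveOn_const_mul_rpow` — convexity bookkeeping;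
* `hasDerivAt_N`, `hasDerivAt_LdivN` — the derivatives of `N = √Q` and of `L/N` (`= Δ²/N³`);
* `pastModel_five_zeros` — THE PAST-TYPE ANALYTIC LEMMA (five zeros `0 < y₀ < ⋯ < y₄` are impossible);
* **`pastType_five_roots`** — pencil form: `S₀ + x^d·1 + x^e·S₂` has no five positive det-roots of negative type;
  `card_pastType_le_four` — finset form.

With the companion (future type ≤ 2) this is NOT yet IDL(3) (`≤ 4` roots in all): the joint exclusion needs the one-nappe step
(memo §3 (Walk): a lens and a wrap cannot coexist at `K = 3`), left to the successor.  [folklore] Rolle, convexity of the norm,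
strict concavity of `y ↦ y^b` (`0 < b < 1`); elementary.  Axioms standard; no definitions.
-/

-- the D-0017 layout repeats a namespace component (single-conjunct summit); the `dupNamespace` linter flags it; name mandated.
set_option linter.dupNamespace false

namespace Summit.ValiantsHypothesis.ValiantsHypothesis.Theorems.LacunarySymmetroidMatrixDescartes.Census.DefiniteMiddle

open Real Matrix Finset
open scoped BigOperators

/-! ## §1 Convexity bookkeeping -/

/-- A strictly convex function on `(0,∞)` does not vanish at three points `0 < y₁ < y₂ < y₃`. [folklore] -/
theorem three_zeros_of_strictConvexOn {f : ℝ → ℝ} (hf : StrictConvexOn ℝ (Set.Ioi (0:ℝ)) f)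
    {y₁ y₂ y₃ : ℝ} (h0 : 0 < y₁) (h12 : y₁ < y₂) (h23 : y₂ < y₃)
    (hz1 : f y₁ = 0) (hz2 : f y₂ = 0) (hz3 : f y₃ = 0) : False :=
  three_zeros_of_strictConcaveOn hf.neg h0 h12 h23 (by simp [hz1]) (by simp [hz2]) (by simp [hz3])

/-- `y ↦ c·y^b` is strictly concave on `(0,∞)` for `c > 0`, `0 < b < 1`. [folklore] -/
theorem strictConcaveOn_const_mul_rpow {c b : ℝ} (hc : 0 < c) (hb0 : 0 < b) (hb1 : b < 1) :
    StrictConcaveOn ℝ (Set.Ioi (0:ℝ)) (fun y : ℝ => c * y ^ b) := by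
  have h1 : StrictConcaveOn ℝ (Set.Ioi (0:ℝ)) (fun y : ℝ => y ^ b) :=
    (Real.strictConcaveOn_rpow hb0 hb1).subset Set.Ioi_subset_Ici_self (convex_Ioi 0)
  refine ⟨convex_Ioi 0, ?_⟩
  intro x hx z hz hxz α β hα hβ hαβ
  have h := h1.2 hx hz hxz hα hβ hαβ
  simp only [smul_eq_mul] at h ⊢
  have := mul_lt_mul_of_pos_left h hc
  nlinarith [this]

/-! ## §2 Derivatives of `N = √Q` and of `L/N` -/

/-- Derivative of `Q(y) = (p₁ + y q₁)² + (p₂ + y q₂)²`: `Q' = 2L`, `L = (p₁ + y q₁)q₁ + (p₂ + y q₂)q₂`. [folklore] -/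
theorem hasDerivAt_Q (p₁ p₂ q₁ q₂ y : ℝ) :
    HasDerivAt (fun y : ℝ => (p₁ + y * q₁) ^ 2 + (p₂ + y * q₂) ^ 2)
      (2 * ((p₁ + y * q₁) * q₁ + (p₂ + y * q₂) * q₂)) y := by
  have h1 : HasDerivAt (fun y : ℝ => p₁ + y * q₁) q₁ y := by
    simpa using ((hasDerivAt_id y).mul_const q₁).const_add p₁
  have h2 : HasDerivAt (fun y : ℝ => p₂ + y * q₂) q₂ y := by
    simpa using ((hasDerivAt_id y).mul_const q₂).const_add p₂
  have h := (h1.fun_pow 2).fun_add (h2.fun_pow 2)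
  refine h.congr_deriv ?_
  simp only [Nat.cast_ofNat, Nat.add_one_sub_one, pow_one]
  ring

/-- Derivative of `N = √Q` where `Q > 0`: `N' = L/N`. [folklore] -/
theorem hasDerivAt_N (p₁ p₂ q₁ q₂ y : ℝ) (hQ : 0 < (p₁ + y * q₁) ^ 2 + (p₂ + y * q₂) ^ 2) :
    HasDerivAt (fun y : ℝ => Real.sqrt ((p₁ + y * q₁) ^ 2 + (p₂ + y * q₂) ^ 2))
      (((p₁ + y * q₁) * q₁ + (p₂ + y * q₂) * q₂) / Real.sqrt ((p₁ + y * q₁) ^ 2 + (p₂ + y * q₂) ^ 2)) y := by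
  have h := (hasDerivAt_Q p₁ p₂ q₁ q₂ y).sqrt hQ.ne'
  refine h.congr_deriv ?_
  rw [mul_div_mul_left _ _ (two_ne_zero)]

/-- Quotient-rule algebra: `(σS − L·(L/S))/S² = Δ²/S³` when `S² = Q` and `σQ − L² = Δ²`. [folklore] -/
theorem quotient_rule_algebra (σ' L D S Q : ℝ) (hS : 0 < S) (hS2 : S ^ 2 = Q) (hl : σ' * Q - L ^ 2 = D ^ 2) :
    (σ' * S - L * (L / S)) / S ^ 2 = D ^ 2 / S ^ 3 := by
  have hS0 : S ≠ 0 := hS.ne'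
  rw [div_eq_div_iff (by positivity) (by positivity)]
  field_simp
  rw [hS2]
  linarith [hl]

/-- Derivative of `L/N` where `Q > 0`: `(L/N)' = Δ²/N³` (Lagrange identity `σQ − L² = Δ²`, `Δ = p₁q₂ − p₂q₁`). [folklore] -/
theorem hasDerivAt_LdivN (p₁ p₂ q₁ q₂ y : ℝ) (hQ : 0 < (p₁ + y * q₁) ^ 2 + (p₂ + y * q₂) ^ 2) :
    HasDerivAt (fun y : ℝ => ((p₁ + y * q₁) * q₁ + (p₂ + y * q₂) * q₂) /
        Real.sqrt ((p₁ + y * q₁) ^ 2 + (p₂ + y * q₂) ^ 2))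
      ((p₁ * q₂ - p₂ * q₁) ^ 2 / Real.sqrt ((p₁ + y * q₁) ^ 2 + (p₂ + y * q₂) ^ 2) ^ 3) y := by
  have hL : HasDerivAt (fun y : ℝ => (p₁ + y * q₁) * q₁ + (p₂ + y * q₂) * q₂) (q₁ * q₁ + q₂ * q₂) y := by
    have h1 : HasDerivAt (fun y : ℝ => p₁ + y * q₁) q₁ y := by
      simpa using ((hasDerivAt_id y).mul_const q₁).const_add p₁
    have h2 : HasDerivAt (fun y : ℝ => p₂ + y * q₂) q₂ y := by
      simpa using ((hasDerivAt_id y).mul_const q₂).const_add p₂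
    exact (h1.mul_const q₁).add (h2.mul_const q₂)
  have hN := hasDerivAt_N p₁ p₂ q₁ q₂ y hQ
  have hNpos : 0 < Real.sqrt ((p₁ + y * q₁) ^ 2 + (p₂ + y * q₂) ^ 2) := Real.sqrt_pos.mpr hQ
  have hN2 : Real.sqrt ((p₁ + y * q₁) ^ 2 + (p₂ + y * q₂) ^ 2) ^ 2 = (p₁ + y * q₁) ^ 2 + (p₂ + y * q₂) ^ 2 :=
    Real.sq_sqrt hQ.le
  have h := hL.fun_div hN hNpos.ne'
  exact h.congr_deriv (quotient_rule_algebra _ _ _ _ _ hNpos hN2 (by ring))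

/-! ## §3 The past-type analytic lemma -/

/-- The algebra at a zero of `H''`: from `a(a−1)w^{a−2} + Δ²/N³ = 0` (`0 < a < 1`, `w, N > 0`) one gets
`N = (Δ²/(a(1−a)))^{1/3} · w^{(2−a)/3}`. [folklore] -/
theorem cube_identity {a Δ Nw w : ℝ} (ha0 : 0 < a) (ha1 : a < 1) (hw : 0 < w) (hN : 0 < Nw)
    (h : a * ((a - 1) * w ^ (a - 1 - 1)) + Δ ^ 2 / Nw ^ 3 = 0) :
    Nw = (Δ ^ 2 / (a * (1 - a))) ^ ((1:ℝ) / 3) * w ^ ((2 - a) / 3) := by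
  have haa : 0 < a * (1 - a) := by nlinarith
  have hK : 0 ≤ Δ ^ 2 / (a * (1 - a)) := by positivity
  have hpow : w ^ (a - 1 - 1) = w ^ a / w ^ 2 := by
    rw [show a - 1 - 1 = a - 2 by ring, Real.rpow_sub hw, Real.rpow_two]
  rw [hpow] at h
  have hwa : 0 < w ^ a := Real.rpow_pos_of_pos hw a
  have hw2 : 0 < w ^ 2 := by positivity
  have hN3 : 0 < Nw ^ 3 := by positivity
  have h1a : 0 < 1 - a := by linarith
  have h1 : Nw ^ 3 = Δ ^ 2 / (a * (1 - a)) * (w ^ 2 / w ^ a) := by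
    field_simp
    field_simp at h
    linarith [h]
  have h2 : ((Δ ^ 2 / (a * (1 - a))) ^ ((1:ℝ) / 3) * w ^ ((2 - a) / 3)) ^ 3
      = Δ ^ 2 / (a * (1 - a)) * (w ^ 2 / w ^ a) := by
    rw [mul_pow, ← Real.rpow_natCast ((Δ ^ 2 / (a * (1 - a))) ^ ((1:ℝ) / 3)) 3, ← Real.rpow_mul hK,
      ← Real.rpow_natCast (w ^ ((2 - a) / 3)) 3, ← Real.rpow_mul hw.le]
    have e1 : (1:ℝ) / 3 * ((3:ℕ) : ℝ) = 1 := by norm_num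
    have e2 : (2 - a) / 3 * ((3:ℕ) : ℝ) = 2 - a := by push_cast; ring
    rw [e1, e2, Real.rpow_one, Real.rpow_sub hw, Real.rpow_two]
  have h3 := h1.trans h2.symm
  exact (Odd.strictMono_pow (by decide : Odd 3)).injective h3

/-- Rolle on `(0,∞)`: two zeros `0 < u < v` of a function differentiable on `(0,∞)` give a zero of its derivative in `(u,v)`.
[folklore] -/
theorem rolle_pos {g g' : ℝ → ℝ} (hder : ∀ x : ℝ, 0 < x → HasDerivAt g (g' x) x) {u v : ℝ} (hu : 0 < u) (huv : u < v)
    (hgu : g u = 0) (hgv : g v = 0) : ∃ c : ℝ, u < c ∧ c < v ∧ g' c = 0 := by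
  have hcont : ContinuousOn g (Set.Icc u v) := fun x hx =>
    (hder x (lt_of_lt_of_le hu hx.1)).continuousAt.continuousWithinAt
  obtain ⟨c, hc, hc0⟩ := exists_hasDerivAt_eq_zero huv hcont (by rw [hgu, hgv])
    (fun x hx => hder x (lt_trans hu hx.1))
  exact ⟨c, hc.1, hc.2, hc0⟩

/-- **THE PAST-TYPE ANALYTIC LEMMA.**  For `0 < a < 1` and reals `t₀ t₂ p₁ p₂ q₁ q₂` the function
`H(y) = y^a + t₀ + t₂·y + √((p₁ + y q₁)² + (p₂ + y q₂)²)` does not vanish at five points `0 < y₀ < y₁ < y₂ < y₃ < y₄`.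
[folklore] -/
theorem pastModel_five_zeros {a : ℝ} (ha0 : 0 < a) (ha1 : a < 1) (t₀ t₂ p₁ p₂ q₁ q₂ : ℝ)
    (y : Fin 5 → ℝ) (hy : StrictMono y) (hy0 : 0 < y 0)
    (hz : ∀ i, y i ^ a + t₀ + t₂ * y i + Real.sqrt ((p₁ + y i * q₁) ^ 2 + (p₂ + y i * q₂) ^ 2) = 0) : False := by
  -- notation
  set Δ : ℝ := p₁ * q₂ - p₂ * q₁ with hΔ
  set σ : ℝ := q₁ * q₁ + q₂ * q₂ with hσ
  have hypos : ∀ i, 0 < y i := fun i => lt_of_lt_of_le hy0 (hy.monotone (Fin.zero_le i))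
  -- the model functions
  set Q : ℝ → ℝ := fun y => (p₁ + y * q₁) ^ 2 + (p₂ + y * q₂) ^ 2 with hQ
  set L : ℝ → ℝ := fun y => (p₁ + y * q₁) * q₁ + (p₂ + y * q₂) * q₂ with hL
  set N : ℝ → ℝ := fun y => Real.sqrt (Q y) with hN
  set H : ℝ → ℝ := fun y => y ^ a + t₀ + t₂ * y + N y with hH
  have lagrange : ∀ x, σ * Q x - L x ^ 2 = Δ ^ 2 := by intro x; simp only [hQ, hL, hσ, hΔ]; ring
  have hHz : ∀ i, H (y i) = 0 := fun i => by simp only [hH, hN, hQ]; exact hz i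
  by_cases hΔ0 : Δ = 0
  · -- ### degenerate case: `N` is piecewise affine
    by_cases hσ0 : σ = 0
    · -- `q = 0`: `N` is constant, `H` strictly concave
      have hq₁ : q₁ = 0 := by nlinarith [sq_nonneg q₁, sq_nonneg q₂]
      have hq₂ : q₂ = 0 := by nlinarith [sq_nonneg q₁, sq_nonneg q₂]
      have hz' : ∀ i, y i ^ a + (t₀ + Real.sqrt (p₁ ^ 2 + p₂ ^ 2)) + t₂ * y i - ‖(0:ℂ) + (y i : ℂ) * 0‖ = 0 := by
        intro i
        have := hz i
        simp only [hq₁, hq₂, mul_zero, add_zero] at this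
        simp only [mul_zero, add_zero, norm_zero, sub_zero]
        linarith
      exact model_three_zeros ha0 ha1 _ _ 0 0 (hypos 0) (hy (by decide : (0:Fin 5) < 1))
        (hy (by decide : (1:Fin 5) < 2)) (hz' 0) (hz' 1) (hz' 2)
    · -- `σ > 0`, `Δ = 0`: `N = |L|/√σ`, kink where `L = 0`
      have hσpos : 0 < σ := lt_of_le_of_ne (by nlinarith [sq_nonneg q₁, sq_nonneg q₂]) (Ne.symm hσ0)
      have hNabs : ∀ x, N x = |L x| / Real.sqrt σ := by
        intro x
        have hQx : Q x = L x ^ 2 / σ := by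
          have := lagrange x; rw [hΔ0] at this
          field_simp; linarith
        simp only [hN]
        rw [hQx, Real.sqrt_div' _ hσpos.le, Real.sqrt_sq_eq_abs]
      -- `L` is affine with slope `σ`: `L x = L 0 + σ x`
      have hLaff : ∀ x, L x = L 0 + σ * x := by intro x; simp only [hL, hσ]; ring
      -- on each side of the kink `H` agrees with a strictly concave model with `q = 0`
      set sσ := Real.sqrt σ with hsσ
      have hsσpos : 0 < sσ := Real.sqrt_pos.mpr hσpos
      -- three of the five zeros lie on one side of the kink `x* : L x* = 0`
      rcases le_or_gt (L (y 2)) 0 with h2 | h2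
      · -- `y 0 < y 1 < y 2` all have `L ≤ 0` (L increasing)
        have hLle : ∀ i : Fin 5, i ≤ 2 → L (y i) ≤ 0 := by
          intro i hi
          have hmon : y i ≤ y 2 := hy.monotone hi
          rw [hLaff] at h2 ⊢; nlinarith
        have hz' : ∀ i : Fin 5, i ≤ 2 →
            y i ^ a + (t₀ - L 0 / sσ) + (t₂ - σ / sσ) * y i - ‖(0:ℂ) + (y i : ℂ) * 0‖ = 0 := by
          intro i hi
          have h1 := hHz i
          simp only [hH] at h1
          rw [hNabs, abs_of_nonpos (hLle i hi), hLaff] at h1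
          simp only [mul_zero, add_zero, norm_zero, sub_zero]
          have e : -(L 0 + σ * y i) / sσ = -(L 0 / sσ) - σ / sσ * y i := by ring
          rw [e] at h1
          linarith
        exact model_three_zeros ha0 ha1 _ _ 0 0 (hypos 0) (hy (by decide : (0:Fin 5) < 1))
          (hy (by decide : (1:Fin 5) < 2)) (hz' 0 (by decide)) (hz' 1 (by decide)) (hz' 2 (by decide))
      · -- `y 2 < y 3 < y 4` all have `L > 0`
        have hLge : ∀ i : Fin 5, 2 ≤ i → 0 ≤ L (y i) := by
          intro i hi
          have hmon : y 2 ≤ y i := hy.monotone hi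
          rw [hLaff] at h2 ⊢; nlinarith
        have hz' : ∀ i : Fin 5, 2 ≤ i →
            y i ^ a + (t₀ + L 0 / sσ) + (t₂ + σ / sσ) * y i - ‖(0:ℂ) + (y i : ℂ) * 0‖ = 0 := by
          intro i hi
          have h1 := hHz i
          simp only [hH] at h1
          rw [hNabs, abs_of_nonneg (hLge i hi), hLaff] at h1
          simp only [mul_zero, add_zero, norm_zero, sub_zero]
          have e : (L 0 + σ * y i) / sσ = L 0 / sσ + σ / sσ * y i := by ring
          rw [e] at h1
          linarith
        exact model_three_zeros ha0 ha1 _ _ 0 0 (hypos 2) (hy (by decide : (2:Fin 5) < 3))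
          (hy (by decide : (3:Fin 5) < 4)) (hz' 2 (by decide)) (hz' 3 (by decide)) (hz' 4 (by decide))
  · -- ### smooth case `Δ ≠ 0`: `Q > 0` everywhere
    have hσpos : 0 < σ := by
      rcases eq_or_lt_of_le (show 0 ≤ σ by nlinarith [sq_nonneg q₁, sq_nonneg q₂]) with h | h
      · exfalso
        have hq₁ : q₁ = 0 := by nlinarith [sq_nonneg q₁, sq_nonneg q₂]
        have hq₂ : q₂ = 0 := by nlinarith [sq_nonneg q₁, sq_nonneg q₂]
        apply hΔ0; simp only [hΔ, hq₁, hq₂]; ring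
      · exact h
    have hQpos : ∀ x, 0 < Q x := by
      intro x
      have h1 := lagrange x
      have h2 : 0 < Δ ^ 2 := by positivity
      rcases lt_or_ge 0 (Q x) with hlt | hle
      · exact hlt
      · exfalso; nlinarith [sq_nonneg (L x)]
    have hNpos : ∀ x, 0 < N x := fun x => Real.sqrt_pos.mpr (hQpos x)
    have hN2 : ∀ x, N x ^ 2 = Q x := fun x => Real.sq_sqrt (hQpos x).le
    -- first and second derivatives of `H` on `(0,∞)`
    set H' : ℝ → ℝ := fun y => a * y ^ (a - 1) + t₂ + L y / N y with hH'
    set H'' : ℝ → ℝ := fun y => a * ((a - 1) * y ^ (a - 1 - 1)) + Δ ^ 2 / N y ^ 3 with hH''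
    have hderH : ∀ x : ℝ, 0 < x → HasDerivAt H (H' x) x := by
      intro x hx
      have h1 : HasDerivAt (fun y : ℝ => y ^ a) (a * x ^ (a - 1)) x := Real.hasDerivAt_rpow_const (Or.inl hx.ne')
      have h3 : HasDerivAt N (L x / N x) x := hasDerivAt_N p₁ p₂ q₁ q₂ x (hQpos x)
      have h2' : HasDerivAt (fun y : ℝ => t₂ * y) t₂ x := by
        simpa using ((hasDerivAt_id x).const_mul t₂)
      exact ((h1.add_const t₀).fun_add h2').fun_add h3
    have hderH' : ∀ x : ℝ, 0 < x → HasDerivAt H' (H'' x) x := by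
      intro x hx
      have h1 : HasDerivAt (fun y : ℝ => a * y ^ (a - 1)) (a * ((a - 1) * x ^ (a - 1 - 1))) x :=
        (Real.hasDerivAt_rpow_const (Or.inl hx.ne')).const_mul a
      have h2 : HasDerivAt (fun y : ℝ => a * y ^ (a - 1) + t₂) (a * ((a - 1) * x ^ (a - 1 - 1))) x :=
        h1.add_const t₂
      have h3 : HasDerivAt (fun y => L y / N y) (Δ ^ 2 / N x ^ 3) x := hasDerivAt_LdivN p₁ p₂ q₁ q₂ x (hQpos x)
      exact h2.fun_add h3
    -- Rolle twice: five zeros of `H` ⇒ four of `H'` ⇒ three of `H''`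
    have hz01 := rolle_pos hderH (hypos 0) (hy (by decide : (0:Fin 5) < 1)) (hHz 0) (hHz 1)
    have hz12 := rolle_pos hderH (hypos 1) (hy (by decide : (1:Fin 5) < 2)) (hHz 1) (hHz 2)
    have hz23 := rolle_pos hderH (hypos 2) (hy (by decide : (2:Fin 5) < 3)) (hHz 2) (hHz 3)
    have hz34 := rolle_pos hderH (hypos 3) (hy (by decide : (3:Fin 5) < 4)) (hHz 3) (hHz 4)
    obtain ⟨z₀, hz₀l, hz₀r, hz₀⟩ := hz01
    obtain ⟨z₁, hz₁l, hz₁r, hz₁⟩ := hz12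
    obtain ⟨z₂, hz₂l, hz₂r, hz₂⟩ := hz23
    obtain ⟨z₃, hz₃l, hz₃r, hz₃⟩ := hz34
    have hz₀pos : 0 < z₀ := lt_trans (hypos 0) hz₀l
    have hz₁pos : 0 < z₁ := lt_trans (hypos 1) hz₁l
    have hz₂pos : 0 < z₂ := lt_trans (hypos 2) hz₂l
    obtain ⟨w₀, hw₀l, hw₀r, hw₀⟩ := rolle_pos hderH' hz₀pos (lt_trans hz₀r hz₁l) hz₀ hz₁
    obtain ⟨w₁, hw₁l, hw₁r, hw₁⟩ := rolle_pos hderH' hz₁pos (lt_trans hz₁r hz₂l) hz₁ hz₂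
    obtain ⟨w₂, hw₂l, hw₂r, hw₂⟩ := rolle_pos hderH' hz₂pos (lt_trans hz₂r hz₃l) hz₂ hz₃
    have hw₀pos : 0 < w₀ := lt_trans hz₀pos hw₀l
    have hw₁pos : 0 < w₁ := lt_trans hz₁pos hw₁l
    have hw₂pos : 0 < w₂ := lt_trans hz₂pos hw₂l
    have hw01 : w₀ < w₁ := lt_trans hw₀r hw₁l
    have hw12 : w₁ < w₂ := lt_trans hw₁r hw₂l
    -- at a zero `w` of `H''`: `N w = c · w^b`, `b = (2 - a)/3`, `c = (Δ²/(a(1−a)))^{1/3}`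
    have hb0 : 0 < (2 - a) / 3 := by linarith
    have hb1 : (2 - a) / 3 < 1 := by linarith
    have hcpos : 0 < (Δ ^ 2 / (a * (1 - a))) ^ ((1:ℝ) / 3) := by
      have : 0 < Δ ^ 2 := by positivity
      have : 0 < a * (1 - a) := by nlinarith
      exact Real.rpow_pos_of_pos (by positivity) _
    have key : ∀ w : ℝ, 0 < w → H'' w = 0 →
        N w = (Δ ^ 2 / (a * (1 - a))) ^ ((1:ℝ) / 3) * w ^ ((2 - a) / 3) :=
      fun w hw hHw => cube_identity ha0 ha1 hw (hNpos w) hHw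
    -- `Ψ = c·y^b − N` is strictly concave on `(0,∞)` and vanishes at `w₀ < w₁ < w₂`
    have hNnorm : ∀ x, N x = ‖((p₁ : ℂ) + (p₂ : ℂ) * Complex.I) + (x : ℂ) * ((q₁ : ℂ) + (q₂ : ℂ) * Complex.I)‖ := by
      intro x
      simp only [hN, hQ]
      rw [Complex.norm_eq_sqrt_sq_add_sq]
      congr 1
      simp only [Complex.add_re, Complex.add_im, Complex.mul_re, Complex.mul_im, Complex.ofReal_re, Complex.ofReal_im,
        Complex.I_re, Complex.I_im, mul_zero, mul_one, zero_mul, sub_zero, add_zero, zero_add]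
    have hΨ : StrictConcaveOn ℝ (Set.Ioi (0:ℝ)) (fun x : ℝ => (Δ ^ 2 / (a * (1 - a))) ^ ((1:ℝ) / 3) * x ^ ((2 - a) / 3) +
        -‖((p₁ : ℂ) + (p₂ : ℂ) * Complex.I) + (x : ℂ) * ((q₁ : ℂ) + (q₂ : ℂ) * Complex.I)‖) :=
      (strictConcaveOn_const_mul_rpow hcpos hb0 hb1).add_concaveOn (concaveOn_neg_norm_affine _ _)
    have hΨz : ∀ w : ℝ, 0 < w → H'' w = 0 →
        (Δ ^ 2 / (a * (1 - a))) ^ ((1:ℝ) / 3) * w ^ ((2 - a) / 3) +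
          -‖((p₁ : ℂ) + (p₂ : ℂ) * Complex.I) + (w : ℂ) * ((q₁ : ℂ) + (q₂ : ℂ) * Complex.I)‖ = 0 := by
      intro w hw hHw
      rw [← hNnorm, key w hw hHw]; ring
    exact three_zeros_of_strictConcaveOn hΨ hw₀pos hw01 hw12 (hΨz w₀ hw₀pos hw₀) (hΨz w₁ hw₁pos hw₁)
      (hΨz w₂ hw₂pos hw₂)


/-! ## §4 Pencil form: at most four positive det-roots of negative type -/

/-- **A negative-type det-root is a zero of the past model at `y = x^e`.**  If `x > 0`, `det F(x) = 0` and `tr F(x) ≤ 0` for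
`F(x) = S₀ + x^d·1 + x^e·S₂` (`S₀, S₂` symmetric, `0 < e`) then
`y^{d/e} + t₀ + t₂y + √((p₁ + y q₁)² + (p₂ + y q₂)²) = 0` at `y = x^e`, with `t₀ = tr S₀/2`, `t₂ = tr S₂/2`,
`(p₁,p₂) = (S₀ ₀₁, (S₀ ₀₀ − S₀ ₁₁)/2)`, `(q₁,q₂)` likewise for `S₂`. [folklore] -/
theorem pastModel_eq_zero_of_root (S₀ S₂ : Matrix (Fin 2) (Fin 2) ℝ) (hS₀ : S₀.IsSymm) (hS₂ : S₂.IsSymm)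
    {d e : ℕ} (he : 0 < e) {x : ℝ} (hx : 0 < x)
    (hdet : (S₀ + x ^ d • (1 : Matrix (Fin 2) (Fin 2) ℝ) + x ^ e • S₂).det = 0)
    (htr : (S₀ + x ^ d • (1 : Matrix (Fin 2) (Fin 2) ℝ) + x ^ e • S₂).trace ≤ 0) :
    (x ^ e) ^ ((d : ℝ) / e) + (S₀ 0 0 + S₀ 1 1) / 2 + (S₂ 0 0 + S₂ 1 1) / 2 * x ^ e
      + Real.sqrt ((S₀ 0 1 + x ^ e * S₂ 0 1) ^ 2 + ((S₀ 0 0 - S₀ 1 1) / 2 + x ^ e * ((S₂ 0 0 - S₂ 1 1) / 2)) ^ 2) = 0 := by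
  have hpow : (x ^ e) ^ ((d : ℝ) / e) = x ^ d := by
    rw [← Real.rpow_natCast x e, ← Real.rpow_mul hx.le, ← Real.rpow_natCast x d]
    congr 1
    have : (e : ℝ) ≠ 0 := by exact_mod_cast he.ne'
    field_simp
  rw [hpow]
  set A : ℝ := x ^ d + (S₀ 0 0 + S₀ 1 1) / 2 + (S₂ 0 0 + S₂ 1 1) / 2 * x ^ e with hA
  set Z : ℂ := (((S₀ 0 1 : ℝ) : ℂ) + ((S₀ 0 0 - S₀ 1 1) / 2 : ℝ) * Complex.I)
          + ((x ^ e : ℝ) : ℂ) * (((S₂ 0 1 : ℝ) : ℂ) + ((S₂ 0 0 - S₂ 1 1) / 2 : ℝ) * Complex.I) with hZ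
  have hZnorm : ‖Z‖ = Real.sqrt ((S₀ 0 1 + x ^ e * S₂ 0 1) ^ 2
      + ((S₀ 0 0 - S₀ 1 1) / 2 + x ^ e * ((S₂ 0 0 - S₂ 1 1) / 2)) ^ 2) := by
    rw [hZ, Complex.norm_eq_sqrt_sq_add_sq]
    congr 1
    simp only [Complex.add_re, Complex.add_im, Complex.mul_re, Complex.mul_im, Complex.ofReal_re, Complex.ofReal_im,
      Complex.I_re, Complex.I_im, mul_zero, mul_one, zero_mul, sub_zero, add_zero, zero_add]
  have hA0 : A ≤ 0 := by
    have := halfTrace_eq S₀ S₂ d e x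
    rw [hA]; linarith
  have hsq : A ^ 2 - ‖Z‖ ^ 2 = 0 := by
    rw [hA, hZ, ← det_eq_halfTrace_sq_sub_normSq S₀ S₂ hS₀ hS₂ d e x]; exact hdet
  have hAZ : ‖Z‖ = -A := by
    rw [← Real.sqrt_sq (norm_nonneg Z), ← Real.sqrt_sq (neg_nonneg.mpr hA0)]
    congr 1
    linarith
  rw [← hZnorm]
  linarith

/-- **THE PAST-TYPE LAW at `(2,3)`, identity gauge.**  For real symmetric `S₀, S₂` and exponents `0 < d < e` the pencil
`F(x) = S₀ + x^d·1 + x^e·S₂` does not have five positive det-roots `x₀ < ⋯ < x₄` of negative type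
(`det F(xᵢ) = 0` and `tr F(xᵢ) ≤ 0`, i.e. `F(xᵢ) ⪯ 0`). [folklore] -/
theorem pastType_five_roots (S₀ S₂ : Matrix (Fin 2) (Fin 2) ℝ) (hS₀ : S₀.IsSymm) (hS₂ : S₂.IsSymm)
    {d e : ℕ} (hd : 0 < d) (hde : d < e) (x : Fin 5 → ℝ) (hx : StrictMono x) (hx0 : 0 < x 0)
    (hdet : ∀ i, (S₀ + x i ^ d • (1 : Matrix (Fin 2) (Fin 2) ℝ) + x i ^ e • S₂).det = 0)
    (htr : ∀ i, (S₀ + x i ^ d • (1 : Matrix (Fin 2) (Fin 2) ℝ) + x i ^ e • S₂).trace ≤ 0) : False := by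
  have he : 0 < e := lt_trans hd hde
  have ha0 : 0 < (d : ℝ) / e := div_pos (by exact_mod_cast hd) (by exact_mod_cast he)
  have ha1 : (d : ℝ) / e < 1 := (div_lt_one (by exact_mod_cast he)).mpr (by exact_mod_cast hde)
  have hxpos : ∀ i, 0 < x i := fun i => lt_of_lt_of_le hx0 (hx.monotone (Fin.zero_le i))
  have hy : StrictMono (fun i => x i ^ e) := fun i j hij => pow_lt_pow_left₀ (hx hij) (hxpos i).le he.ne'
  refine pastModel_five_zeros ha0 ha1 ((S₀ 0 0 + S₀ 1 1) / 2) ((S₂ 0 0 + S₂ 1 1) / 2) (S₀ 0 1)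
    ((S₀ 0 0 - S₀ 1 1) / 2) (S₂ 0 1) ((S₂ 0 0 - S₂ 1 1) / 2) (fun i => x i ^ e) hy (pow_pos hx0 e) ?_
  intro i
  have h := pastModel_eq_zero_of_root S₀ S₂ hS₀ hS₂ he (hxpos i) (hdet i) (htr i)
  simpa only using h

/-- **Finset form: at most FOUR positive det-roots of negative type** for `F(x) = S₀ + x^d·1 + x^e·S₂`
(`S₀, S₂` real symmetric, `0 < d < e`). [folklore] -/
theorem card_pastType_le_four (S₀ S₂ : Matrix (Fin 2) (Fin 2) ℝ) (hS₀ : S₀.IsSymm) (hS₂ : S₂.IsSymm)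
    {d e : ℕ} (hd : 0 < d) (hde : d < e) (T : Finset ℝ)
    (hT : ∀ x ∈ T, 0 < x ∧ (S₀ + x ^ d • (1 : Matrix (Fin 2) (Fin 2) ℝ) + x ^ e • S₂).det = 0 ∧
      (S₀ + x ^ d • (1 : Matrix (Fin 2) (Fin 2) ℝ) + x ^ e • S₂).trace ≤ 0) :
    T.card ≤ 4 := by
  by_contra hlt
  have h5 : 5 ≤ T.card := by omega
  set r := T.orderEmbOfFin rfl with hr
  have hmem : ∀ i, r i ∈ T := fun i => Finset.orderEmbOfFin_mem T rfl i
  let x : Fin 5 → ℝ := fun i => r ⟨i, by omega⟩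
  have hx : StrictMono x := fun i j hij => r.strictMono (Fin.mk_lt_mk.mpr (Fin.lt_def.mp hij))
  exact pastType_five_roots S₀ S₂ hS₀ hS₂ hd hde x hx (hT _ (hmem _)).1 (fun i => (hT _ (hmem _)).2.1)
    (fun i => (hT _ (hmem _)).2.2)

end Summit.ValiantsHypothesis.ValiantsHypothesis.Theorems.LacunarySymmetroidMatrixDescartes.Census.DefiniteMiddle
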